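import Mathlib.Analysis.Calculus.DifferentialForm.Basic
import Mathlib.Geometry.Manifold.MFDeriv.Atlas
import Mathlib.Geometry.Manifold.MFDeriv.SpecificFunctions
import Mathlib.Geometry.Manifold.VectorBundle.Tangent
import Mathlib.Topology.VectorBundle.ContinuousAlternatingMap
import Mathlib.Geometry.Manifold.ContMDiff.Defs
import Mathlib.LinearAlgebra.Quotient.Basic
import HarnessLib

-- provenance: harness21/H21/H21/Prelude/Kaehler/ManifoldForms.lean @ 8a3fbaf (interim HEAD d8f2665); M5 mechanical rewrite
/-!
# Differential forms on real manifolds (statement-enabling slice)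

Trunk: Kähler / Hodge (`H21/Outlines/Kaehler.md`, §K3 and design note D1).

This file is a deliberately thin, *definition-only* slice of the theory of differential forms
on a real manifold `M` modelled on `I : ModelWithCorners ℝ E H`, with values in a real normed
space `F`. It provides exactly what the downstream statement files (Riemannian Hodge theory,
Kähler manifolds, the Hodge theorem for real forms) consume; the deep properties of `d` are
two named facts (`def … : Prop`, D-0014: `isSmoothForm_iff_contMDiff_totalSpace` and the
chart-independence `inChart_mextDeriv`) taken as hypotheses; smoothness of `dα` and `d ∘ d = 0`
are proved from the latter (the interim file had every deep property as a sorried theorem).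

## Main definitions

* `Literature.MForm I M F k`: `k`-forms on `M`, as dependent functions
  `(x : M) → TangentSpace I x [⋀^Fin k]→L[ℝ] F` (unbundled sections of Mathlib's bundle of
  continuous alternating maps, exactly as Mathlib's `extDeriv` treats forms on a normed space
  as `E → E [⋀^Fin n]→L[𝕜] F`).
* `Literature.MForm.inChart α x₀`: the local representative of `α` in the extended chart at `x₀`
  (pull-back of `α` along `(extChartAt I x₀).symm`).
* `Literature.IsSmoothForm α`: chart-wise `C^∞` smoothness (the `∞` case only, no regularity
  parameter; Mathlib's bundled spelling would be a `ContMDiff` section of the bundle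
  `Bundle.continuousAlternatingMap`, cf. `ContMDiffSection` — see
  `Literature.Geometry.Kaehler.isSmoothForm_iff_contMDiff_totalSpace`).
* `Literature.mextDeriv α`: the exterior derivative `dα`, computed at each point `x` in the preferred
  chart at `x` via Mathlib's `extDerivWithin _ (range I)` and pulled back by
  `mfderiv I 𝓘(ℝ, E) (extChartAt I x) x` (the `mfderiv` pattern).
* `Literature.Geometry.Kaehler.IsClosedForm`, `Literature.Geometry.Kaehler.smoothForms`, `Literature.Geometry.Kaehler.closedSmoothForms`, `Literature.Geometry.Kaehler.exactSmoothForms`,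
  `Literature.Geometry.Kaehler.mextDerivₗ`.
* `Literature.deRhamCohomology I M F k`: closed smooth `k`-forms modulo exact ones, with its
  `ℝ`-module structure and the projection `Literature.Geometry.Kaehler.deRhamCohomology.mk`.

## Mathlib status

Mathlib (pinned v4.32.0) has the exterior derivative on normed spaces
(`extDeriv`, `extDerivWithin`, `extDeriv_extDeriv`, `extDerivWithin_pullback` in
`Mathlib.Analysis.Calculus.DifferentialForm.Basic`), the tangent bundle, and the vector bundle
of continuous alternating maps (`Mathlib.Topology.VectorBundle.ContinuousAlternatingMap`), but no
exterior derivative or de Rham cohomology on manifolds. We reuse all of the former and add only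
the manifold glue. The normalisation of `d` is Mathlib's:
`dα(x; v₀, …, vₙ) = ∑ᵢ (-1)^i D_x α(x; v₀, …, v̂ᵢ, …, vₙ) · vᵢ`.

## Design notes

* `[IsManifold I ∞ M]` is assumed only where it is used: the comparison with bundled
  smoothness, the deep property of `d` (the named fact `inChart_mextDeriv`, from which
  `isSmoothForm_mextDeriv` and `mextDeriv_mextDeriv` are proved) and what depends on them
  (`mextDerivₗ`,
  `exactSmoothForms_le_closedSmoothForms`). The bare definitions (`mextDeriv`, the submodules,
  `deRhamCohomology`) elaborate on any charted space, like Mathlib's `mfderiv`.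
* `exactSmoothForms` is defined by pattern matching on the degree (`0 ↦ ⊥`,
  `k + 1 ↦ span (d '' smooth k-forms)`), avoiding natural-number subtraction.
* The `AddCommGroup`/`Module ℝ` instances on `deRhamCohomology` are given explicitly
  (`Submodule.Quotient.addCommGroup _`, `Submodule.Quotient.module _`); instance search through
  the type synonym is too slow otherwise. They do not override any Mathlib instance.
* Forms are never named `ω` (a reserved token under `open scoped Manifold ContDiff`).

## References

* F. W. Warner, *Foundations of Differentiable Manifolds and Lie Groups* (1983), Ch. 2
  (forms, `d`), Ch. 4 (de Rham cohomology).
* R. Bott, L. W. Tu, *Differential Forms in Algebraic Topology* (1982), §I.1–I.2.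
-/

noncomputable section

open scoped Manifold ContDiff Topology
open Bundle Set

namespace Literature.Geometry.Kaehler

variable {E : Type*} [NormedAddCommGroup E] [NormedSpace ℝ E]
  {H : Type*} [TopologicalSpace H] (I : ModelWithCorners ℝ E H)
  (M : Type*) [TopologicalSpace M] [ChartedSpace H M]
  (F : Type*) [NormedAddCommGroup F] [NormedSpace ℝ F]

/-- A (not necessarily smooth) differential `k`-form on the manifold `M` with values in `F`:
a dependent function assigning to each `x : M` a continuous alternating `k`-linear map on the
tangent space `TangentSpace I x` (definitionally `E`). This is a real vector space via the `Pi`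
instances. Warner (1983), Def. 2.15; cf. Mathlib's `extDeriv` (forms on a normed space as
`E → E [⋀^Fin n]→L[𝕜] F`). [cite: Warner1983] -/
abbrev MForm (k : ℕ) : Type _ := (x : M) → TangentSpace I x [⋀^Fin k]→L[ℝ] F

variable {I M F} {k : ℕ}

namespace MForm

/-- The local representative of a form `α` in the extended chart at `x₀`: the form on the model
space `E` given at `y : E` by pulling back `α ((extChartAt I x₀).symm y)` along the derivative
`mfderivWithin 𝓘(ℝ, E) I (extChartAt I x₀).symm (range I) y` of the inverse chart. Only the
values on `(extChartAt I x₀).target ⊆ range I` are meaningful. Warner (1983), §2.18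
(local expression of a form). [cite: Warner1983] -/
def inChart (α : MForm I M F k) (x₀ : M) : E → E [⋀^Fin k]→L[ℝ] F := fun y ↦
  (α ((extChartAt I x₀).symm y)).compContinuousLinearMap
    (mfderivWithin 𝓘(ℝ, E) I (extChartAt I x₀).symm (range I) y)

/-- Unfolding `MForm.inChart`: the chart representative at `y` evaluates `α` at
`(extChartAt I x₀).symm y` on the push-forwards of the vectors by the derivative of the inverse
chart (Warner (1983), §2.18). [folklore] -/
@[simp]
theorem inChart_apply (α : MForm I M F k) (x₀ : M) (y : E) (v : Fin k → E) :
    α.inChart x₀ y v =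
      α ((extChartAt I x₀).symm y)
        (fun i ↦ mfderivWithin 𝓘(ℝ, E) I (extChartAt I x₀).symm (range I) y (v i)) :=
  rfl

/-- The chart representative is additive in the form (Warner (1983), §2.18). [cite: Warner1983] -/
@[simp]
theorem inChart_add (α β : MForm I M F k) (x₀ : M) :
    (α + β).inChart x₀ = α.inChart x₀ + β.inChart x₀ :=
  rfl

/-- The chart representative commutes with scalar multiplication (Warner (1983), §2.18). [cite: Warner1983] -/
@[simp]
theorem inChart_smul (c : ℝ) (α : MForm I M F k) (x₀ : M) :
    (c • α).inChart x₀ = c • α.inChart x₀ :=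
  rfl

/-- The chart representative of the zero form is zero (Warner (1983), §2.18). [cite: Warner1983] -/
@[simp]
theorem inChart_zero (x₀ : M) : (0 : MForm I M F k).inChart x₀ = 0 :=
  rfl

end MForm

/-- Chart-wise smoothness of a form: `α` is smooth if, for every `x : M`, its representative in
the extended chart at `x` is `C^∞` within `range I` at `extChartAt I x x`. This is the `C^∞`
case only (deliberately no regularity parameter); Mathlib's bundled spelling is a `C^∞` section
of the vector bundle `fun x ↦ TangentSpace I x [⋀^Fin k]→L[ℝ] (Bundle.Trivial M F) x`
(`Bundle.ContinuousAlternatingMap.instVectorBundle`), cf. `ContMDiffSection` and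
`Literature.Geometry.Kaehler.isSmoothForm_iff_contMDiff_totalSpace`.
Warner (1983), Def. 2.15. [cite: Warner1983] -/
def IsSmoothForm (α : MForm I M F k) : Prop :=
  ∀ x, ContDiffWithinAt ℝ ∞ (α.inChart x) (range I) (extChartAt I x x)

/-- The zero form is smooth (Warner (1983), §2.15). [cite: Warner1983] -/
theorem isSmoothForm_zero : IsSmoothForm (0 : MForm I M F k) := fun x ↦ by
  rw [MForm.inChart_zero]
  exact contDiffWithinAt_const (c := 0)

/-- The sum of two smooth forms is smooth (Warner (1983), §2.15). [cite: Warner1983] -/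
theorem IsSmoothForm.add {α β : MForm I M F k} (hα : IsSmoothForm α) (hβ : IsSmoothForm β) :
    IsSmoothForm (α + β) := fun x ↦ by
  rw [MForm.inChart_add]
  exact (hα x).add (hβ x)

/-- A scalar multiple of a smooth form is smooth (Warner (1983), §2.15). [cite: Warner1983] -/
theorem IsSmoothForm.smul (c : ℝ) {α : MForm I M F k} (hα : IsSmoothForm α) :
    IsSmoothForm (c • α) := fun x ↦ by
  rw [MForm.inChart_smul]
  exact (hα x).const_smul c

variable (I M F k) in
/-- The `ℝ`-submodule of smooth `k`-forms on `M` (Warner (1983), Def. 2.15: `E^k(M)`). [cite: Warner1983] -/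
def smoothForms : Submodule ℝ (MForm I M F k) where
  carrier := {α | IsSmoothForm α}
  add_mem' hα hβ := hα.add hβ
  zero_mem' := isSmoothForm_zero
  smul_mem' c _ hα := hα.smul c

/-- Membership in `smoothForms` unfolds to `IsSmoothForm` (Warner (1983), Def. 2.15). [folklore] -/
@[simp]
theorem mem_smoothForms_iff (α : MForm I M F k) : α ∈ smoothForms I M F k ↔ IsSmoothForm α :=
  Iff.rfl

/-! ### The exterior derivative and de Rham cohomology -/

section Deriv

/-- The exterior derivative `dα` of a `k`-form on a manifold: at `x : M` it is Mathlib's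
`extDerivWithin` of the chart representative `α.inChart x` within `range I` at
`extChartAt I x x`, pulled back to `TangentSpace I x` along
`mfderiv I 𝓘(ℝ, E) (extChartAt I x) x`. For smooth forms this is independent of the chart
(`Literature.Geometry.Kaehler.inChart_mextDeriv`). Normalisation as in Mathlib's `extDeriv`.
Warner (1983), Thm. 2.20; Bott–Tu (1982), §I.1. [cite: Warner1983] -/
def mextDeriv (α : MForm I M F k) : MForm I M F (k + 1) := fun x ↦
  (extDerivWithin (α.inChart x) (range I) (extChartAt I x x)).compContinuousLinearMap
    (mfderiv I 𝓘(ℝ, E) (extChartAt I x) x)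

/-- A form is *closed* if its exterior derivative vanishes (Warner (1983), Def. 4.11;
Bott–Tu (1982), §I.1). [cite: Warner1983] -/
def IsClosedForm (α : MForm I M F k) : Prop :=
  mextDeriv α = 0

/-- The exterior derivative is additive on smooth forms (Warner (1983), Thm. 2.20(1)). [cite: Warner1983] -/
theorem mextDeriv_add {α β : MForm I M F k} (hα : IsSmoothForm α) (hβ : IsSmoothForm β) :
    mextDeriv (α + β) = mextDeriv α + mextDeriv β := by
  funext x
  have hU : UniqueDiffWithinAt ℝ (range I) (extChartAt I x x) :=
    I.uniqueDiffOn _ (extChartAt_target_subset_range x (mem_extChartAt_target x))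
  simp only [mextDeriv, MForm.inChart_add]
  rw [extDerivWithin_add hU ((hα x).differentiableWithinAt (by simp))
    ((hβ x).differentiableWithinAt (by simp))]
  rfl

/-- The exterior derivative commutes with scalars (Warner (1983), Thm. 2.20(1)). No smoothness
hypothesis is needed, since `range I` has the unique-differentiability property. [cite: Warner1983] -/
theorem mextDeriv_smul (c : ℝ) (α : MForm I M F k) : mextDeriv (c • α) = c • mextDeriv α := by
  funext x
  have hU : UniqueDiffWithinAt ℝ (range I) (extChartAt I x x) :=
    I.uniqueDiffOn _ (extChartAt_target_subset_range x (mem_extChartAt_target x))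
  simp only [mextDeriv, MForm.inChart_smul]
  rw [extDerivWithin_smul c _ hU]
  rfl

/-- The exterior derivative of the zero form vanishes. [folklore] -/
@[simp]
theorem mextDeriv_zero : mextDeriv (0 : MForm I M F k) = 0 := by
  simpa using mextDeriv_smul (0 : ℝ) (0 : MForm I M F k)

variable (I M F k) in
/-- The `ℝ`-submodule of closed smooth `k`-forms `Z^k(M)` (Warner (1983), Def. 4.11;
Bott–Tu (1982), §I.1). [cite: Warner1983] -/
def closedSmoothForms : Submodule ℝ (MForm I M F k) where
  carrier := {α | IsSmoothForm α ∧ IsClosedForm α}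
  add_mem' {α β} hα hβ := ⟨hα.1.add hβ.1, by
    rw [IsClosedForm, mextDeriv_add hα.1 hβ.1, hα.2, hβ.2, add_zero]⟩
  zero_mem' := ⟨isSmoothForm_zero, mextDeriv_zero⟩
  smul_mem' c α hα := ⟨hα.1.smul c, by rw [IsClosedForm, mextDeriv_smul, hα.2, smul_zero]⟩

/-- Membership in `closedSmoothForms` unfolds to "smooth and closed" (consumed by the Kähler
class construction). [folklore] -/
@[simp]
theorem mem_closedSmoothForms_iff (α : MForm I M F k) :
    α ∈ closedSmoothForms I M F k ↔ IsSmoothForm α ∧ IsClosedForm α :=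
  Iff.rfl

variable (I M F) in
/-- The `ℝ`-submodule of exact smooth `k`-forms `B^k(M)`: `0` in degree `0`, and the span of
the exterior derivatives of smooth `k`-forms in degree `k + 1` (defined by pattern matching to
avoid `k - 1`). Warner (1983), Def. 4.11; Bott–Tu (1982), §I.1. [cite: Warner1983] -/
def exactSmoothForms : (k : ℕ) → Submodule ℝ (MForm I M F k)
  | 0 => ⊥
  | k + 1 => Submodule.span ℝ (mextDeriv '' (smoothForms I M F k : Set (MForm I M F k)))

variable (I M F k) in
/-- The `k`-th de Rham cohomology of `M` with coefficients in `F`: closed smooth `k`-forms modulo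
exact ones, `H^k_{dR}(M; F) = Z^k / B^k`. Warner (1983), Def. 4.11 / §5.28;
Bott–Tu (1982), §I.1. [cite: Warner1983] -/
def deRhamCohomology : Type _ :=
  ↥(closedSmoothForms I M F k) ⧸
    (exactSmoothForms I M F k).comap (closedSmoothForms I M F k).subtype

namespace deRhamCohomology

/-- The additive group structure on de Rham cohomology (the quotient structure, given
explicitly because instance search through the type synonym is slow). [folklore] -/
instance instAddCommGroup : AddCommGroup (deRhamCohomology I M F k) :=
  Submodule.Quotient.addCommGroup _

/-- The `ℝ`-module structure on de Rham cohomology (the quotient structure, given explicitly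
because instance search through the type synonym is slow). [folklore] -/
instance instModule : Module ℝ (deRhamCohomology I M F k) :=
  Submodule.Quotient.module _

/-- The cohomology class `[α]` of a closed smooth form (Warner (1983), Def. 4.11). [cite: Warner1983] -/
def mk : closedSmoothForms I M F k →ₗ[ℝ] deRhamCohomology I M F k :=
  Submodule.mkQ _

/-- Every de Rham cohomology class is represented by a closed smooth form. [folklore] -/
theorem mk_surjective : Function.Surjective (mk : closedSmoothForms I M F k → _) :=
  Submodule.mkQ_surjective _

/-- Two closed smooth forms define the same de Rham class iff their difference is exact
(Warner (1983), Def. 4.11). [cite: Warner1983] -/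
theorem mk_eq_mk_iff (α β : closedSmoothForms I M F k) :
    mk α = mk β ↔ (α : MForm I M F k) - β ∈ exactSmoothForms I M F k :=
  (Submodule.Quotient.eq _).trans Iff.rfl

end deRhamCohomology

end Deriv

section Smooth

variable [IsManifold I ∞ M]

/- Note (M5 migration, D-0014): the two named facts below take `I M F` explicitly and bind
`[IsManifold I ∞ M]` and the degree `k` inside their bodies, so that (a) they state the
literature results for smooth manifolds exactly as the interim theorems did (a `def … : Prop`
does not pick up the unused section instance) and (b) a single witness
`(h : inChart_mextDeriv I M F)` elaborates and serves every degree. The interim sorried theorems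
`isSmoothForm_mextDeriv` and `mextDeriv_mextDeriv` are now proved from that witness. -/

variable (I M F) in
/-- Chart-wise smoothness of a form is equivalent to smoothness of the corresponding section of
Mathlib's vector bundle of continuous alternating maps on the tangent bundle (the bundled
`ContMDiff` spelling, cf. `ContMDiffSection`). Standard; Warner (1983), §2.15–2.18. [cite: Warner1983] -/
def isSmoothForm_iff_contMDiff_totalSpace : Prop :=
  ∀ [IsManifold I ∞ M] {k : ℕ} (α : MForm I M F k),
    IsSmoothForm α ↔
      ContMDiff I (I.prod 𝓘(ℝ, E [⋀^Fin k]→L[ℝ] F)) ∞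
        (fun x ↦ TotalSpace.mk' (E [⋀^Fin k]→L[ℝ] F) x (α x))

variable (I M F) in
/-- Chart independence of `d` near the centre of a chart: for a smooth form `α`, the chart
representative of `dα` in the chart at `x₀` agrees, for `y ∈ range I` near `extChartAt I x₀ x₀`,
with the exterior derivative (within `range I`) of the chart representative of `α`. This is the
manifold form of Mathlib's `extDerivWithin_pullback` (naturality of `d`; Warner (1983),
Thm. 2.20(4) / Prop. 2.23). The equality in fact holds on the whole chart target
`(extChartAt I x₀).target`; only the germ at the centre is recorded, which is all this file
uses. [cite: Warner1983] -/
def inChart_mextDeriv : Prop :=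
  ∀ [IsManifold I ∞ M] {k : ℕ} {α : MForm I M F k}, IsSmoothForm α → ∀ x₀ : M,
    ∀ᶠ y in 𝓝[range I] (extChartAt I x₀ x₀),
      (mextDeriv α).inChart x₀ y = extDerivWithin (α.inChart x₀) (range I) y

/-- `d ∘ d = 0` on smooth forms (Warner (1983), Thm. 2.20(3)), from the chart-independence fact
`inChart_mextDeriv` and Mathlib's `extDerivWithin_extDerivWithin_apply` in the chart at each
point (valid for every model with corners: only `range I ⊆ closure (interior (range I))` is
needed). [cite: Warner1983] -/
theorem mextDeriv_mextDeriv (h : inChart_mextDeriv I M F) {α : MForm I M F k}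
    (hα : IsSmoothForm α) : mextDeriv (mextDeriv α) = 0 := by
  funext x
  have hc : extChartAt I x x ∈ range I :=
    extChartAt_target_subset_range x (mem_extChartAt_target x)
  have h1 := Filter.EventuallyEq.extDerivWithin_eq_of_mem (h hα x) hc
  have hr : minSmoothness ℝ 2 ≤ ∞ := by
    rw [minSmoothness_of_isRCLikeNormedField]
    exact WithTop.coe_le_coe.2 le_top
  simp only [mextDeriv, h1]
  rw [extDerivWithin_extDerivWithin_apply (hα x) hr I.uniqueDiffOn
    (I.range_subset_closure_interior hc) hc]
  rfl

/-- The exterior derivative of a smooth form is smooth (Warner (1983), Thm. 2.20), derived from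
the chart-independence fact `inChart_mextDeriv` (hypothesis `h`): in the chart at `x` the
representative of `dα` is eventually `extDerivWithin` of the representative of `α`, a
continuous linear image (`alternatizeUncurryFinCLM`) of its `fderivWithin`, which is `C^∞`
within `range I`. [cite: Warner1983] -/
theorem isSmoothForm_mextDeriv (h : inChart_mextDeriv I M F) {α : MForm I M F k}
    (hα : IsSmoothForm α) : IsSmoothForm (mextDeriv α) := by
  intro x
  have hc : extChartAt I x x ∈ range I :=
    extChartAt_target_subset_range x (mem_extChartAt_target x)
  have h2 : ContDiffWithinAt ℝ ∞ (extDerivWithin (α.inChart x) (range I)) (range I)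
      (extChartAt I x x) := by
    have hf := (hα x).fderivWithin_right (m := ∞) I.uniqueDiffOn (by simp) hc
    exact (ContinuousAlternatingMap.alternatizeUncurryFinCLM ℝ E F).contDiff.comp_contDiffWithinAt
      hf
  have hx := mem_of_mem_nhdsWithin hc (h hα x)
  exact h2.congr_of_eventuallyEq (h hα x) hx

variable (I M F) in
/-- The exterior derivative as an `ℝ`-linear map from smooth `k`-forms to smooth `(k+1)`-forms
(Warner (1983), Thm. 2.20), under the hypothesis `h : inChart_mextDeriv I M F` (the named fact,
through `isSmoothForm_mextDeriv`). Relies on: inChart_mextDeriv (hypothesis), mextDeriv_add,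
mextDeriv_smul. [cite: Warner1983] -/
def mextDerivₗ (h : inChart_mextDeriv I M F) (k : ℕ) :
    smoothForms I M F k →ₗ[ℝ] smoothForms I M F (k + 1) where
  toFun α := ⟨mextDeriv (α : MForm I M F k), isSmoothForm_mextDeriv h α.2⟩
  map_add' α β := Subtype.ext (mextDeriv_add α.2 β.2)
  map_smul' c α := Subtype.ext (mextDeriv_smul c (α : MForm I M F k))

/-- The linear map `mextDerivₗ` is the exterior derivative `d` on underlying forms
(Warner (1983), Thm. 2.20). [folklore] -/
@[simp]
theorem coe_mextDerivₗ_apply (h : inChart_mextDeriv I M F) (α : smoothForms I M F k) :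
    (mextDerivₗ I M F h k α : MForm I M F (k + 1)) = mextDeriv (α : MForm I M F k) :=
  rfl

/-- Exact forms are closed (`d ∘ d = 0`; Warner (1983), §4.11), under the named fact
`inChart_mextDeriv` as hypothesis. [cite: Warner1983] -/
theorem exactSmoothForms_le_closedSmoothForms (h : inChart_mextDeriv I M F) :
    exactSmoothForms I M F k ≤ closedSmoothForms I M F k := by
  cases k with
  | zero => exact bot_le
  | succ k =>
    refine Submodule.span_le.2 ?_
    rintro _ ⟨α, hα, rfl⟩
    exact ⟨isSmoothForm_mextDeriv h hα, mextDeriv_mextDeriv h hα⟩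

end Smooth

section Flat

/-- In the flat case `M = E`, `I = 𝓘(ℝ, E)`, the manifold exterior derivative is Mathlib's
`extDeriv` (the charts are the identity). [folklore] -/
theorem mextDeriv_eq_extDeriv (α : MForm 𝓘(ℝ, E) E F k) (x : E) :
    mextDeriv α x = extDeriv α x := by
  have h : α.inChart x = α := by
    funext y
    ext v
    simp [MForm.inChart_apply]
    rfl
  ext v
  simp [mextDeriv, h, ContinuousAlternatingMap.compContinuousLinearMap_apply]
  rfl

end Flat

end Literature.Geometry.Kaehler
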